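import Summits.QuantumFields.BalabanUV.T4Continuum.Support.ShellMeasureLogConcaveSU2

/-!
# `T4Continuum.ShellMeasureLogConcaveJacobian` — the `SU(2)` exponential-chart Haar Jacobian is LOG-CONCAVE on the
# injectivity ball (`log ∘ sinc` is concave on `[0, π)`), so member (λ)'s hypothesis (C-ii) concerns the block weight alone
# (cell `pub-balaban`, sub-cell `t4`, spine estimate NE7c (node U5b), lineage t4-ne7c-p1 = PROVER seat P1
# «shell-measure route», generation 24; tree target `Summits/QuantumFields/BalabanUV/T4Continuum/Support/`;
# ADDITIVE — imports `ShellMeasureLogConcaveSU2` only and modifies nothing)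

HONEST FRAMING.  Finite four-torus programme, rung (B)+1 only — NOT infinite volume, NOT a mass gap, NOT the Clay
problem, NOT summit progress.  The cell wall of NE7c — (M1) `T4ShellMeasure.SlotAntiConcentration` FOR BAŁABAN'S
INDUCTIVELY DEFINED EFFECTIVE MEASURES — is NOT PRINTED in [Balaban 1983–89] (GAPS G-ne7cp1-1), asserted by nobody, and
NOT moved by this file.  Every declaration is [folklore] kernel mathematics (one-variable calculus and the product
structure of the tree's exponential cube chart), 0 sorry, 0 citations.

THE POINTS.
* §1 `concaveOn_log_sinc`: `r ↦ log (sinc r)` is CONCAVE on `[0, π)` — on `(0, π)` its derivative is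
  `cot r − 1/r` (`hasDerivAt_log_sinc`), whose derivative `1/r² − 1/sin²r` is `≤ 0` because `sin r ≤ r`
  (`hasDerivAt_cot_sub_inv`, `inv_sq_sub_nonpos`); Mathlib's `AntitoneOn.concaveOn_of_deriv` on the convex set `[0, π)`
  with continuity at `0`.  This is the convexity half of caveat (JAC) of `T4HaarSU2ExpChart` («`g(r) = −2 log sinc r` has
  `g″(r) = 2(1/sin²r − 1/r²)` positive on `(0,π)`», there UNTYPED) — now a kernel fact; the multiplicative three-point
  form `sinc a^{1−s}·sinc b^s ≤ sinc((1−s)a + sb)` is `sinc_threePoint`, and for the radial profile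
  `(2π²)⁻¹sinc²` it is `profile_threePoint`.
* §2 `expWeight_threePoint`: the one-bond exponential Haar weight `(2π²)⁻¹ sinc²‖x‖` satisfies the Prékopa–Leindler
  three-point inequality on the injectivity ball `‖x‖ < π` (norm convexity + the profile is non-increasing on `[0,π]`,
  `ShellMeasureScalingSU2.sinc_le_sinc_of_le_of_le_pi`, + §1); `isLogConcaveWeight_chartWeight`: the chart-side weight
  `1_{[-S,S]ⁿ}·e^{−jac_e}` of the tree's exponential cube chart (`3S² < π²`) is a LOG-CONCAVE WEIGHT on `ℝⁿ`
  (`T4CubeChartExp.exp_neg_expJac`: on the cube it is the product over the bonds of the one-bond weights of the blocks;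
  the cube is convex; blocks and `toE` are linear).
* §3 `slotAntiConcentration_realized_su2_of_logConcave_blockWeight`: the realized member-(λ) headline of
  `ShellMeasureLogConcaveSU2` with (C-ii) asked of the BLOCK WEIGHT ALONE — `x ↦ 1_{[-S,S]ⁿ}(x)·R V(κ x)` log-concave —
  the Jacobian and the window riding free by §2 and `ShellMeasureLogConcave.isLogConcaveWeight_mul`; parity with
  `ShellMeasureScalingSU2.slotAntiConcentration_realized_su2_of_coreMap` («no chart-side binder»).

WHAT THIS DOES NOT DO.  No instance of (C-i)/(C-ii)/(C-iii) for Bałaban's sectioned block weights or classifiers is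
constructed; the size half of (JAC) (a bound on the Hessian of `jac_e`) is not needed by member (λ) and not typed;
NE7c NOT proved.
-/

namespace Summit.QuantumFields.BalabanUV.T4Continuum.ShellMeasureLogConcaveJacobian

open MeasureTheory Set Function Filter Topology
open scoped ENNReal
open Literature.MathematicalPhysics.QuantumFieldTheory.Balaban1983to89
open T4ShellMeasure (SlotAntiConcentration)
open ShellMeasureLogConcave (IsLogConcaveWeight ConvexOnSupport isLogConcaveWeight_mul)

/-! ## §1 `log ∘ sinc` is concave on `[0, π)` -/

section Sinc

/-- `sinc > 0` on `[0, π)`. [folklore] -/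
theorem sinc_pos_of_mem_Ico {r : ℝ} (hr : r ∈ Ico 0 Real.pi) : 0 < Real.sinc r := by
  rcases hr.1.eq_or_lt with h | h
  · rw [← h, Real.sinc_zero]; exact one_pos
  · rw [Real.sinc_of_ne_zero h.ne']; exact div_pos (Real.sin_pos_of_pos_of_lt_pi h hr.2) h

/-- on `(0, π)`: `log ∘ sinc` has derivative `cos r / sin r − r⁻¹`. [folklore] -/
theorem hasDerivAt_log_sinc {r : ℝ} (hr0 : 0 < r) (hrπ : r < Real.pi) :
    HasDerivAt (fun r => Real.log (Real.sinc r)) (Real.cos r / Real.sin r - r⁻¹) r := by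
  have hsin : 0 < Real.sin r := Real.sin_pos_of_pos_of_lt_pi hr0 hrπ
  have hev : (fun r => Real.log (Real.sinc r)) =ᶠ[𝓝 r] fun r => Real.log (Real.sin r) - Real.log r := by
    have h1 : ∀ᶠ r' in 𝓝 r, 0 < r' := lt_mem_nhds hr0
    have h2 : ∀ᶠ r' in 𝓝 r, 0 < Real.sin r' := Real.continuous_sin.continuousAt.eventually (lt_mem_nhds hsin)
    filter_upwards [h1, h2] with r' h1' h2'
    rw [Real.sinc_of_ne_zero h1'.ne', Real.log_div h2'.ne' h1'.ne']
  refine HasDerivAt.congr_of_eventuallyEq ?_ hev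
  have hd1 : HasDerivAt (fun r => Real.log (Real.sin r)) (Real.cos r / Real.sin r) r := by
    simpa using (Real.hasDerivAt_sin r).log hsin.ne'
  exact hd1.sub (Real.hasDerivAt_log hr0.ne')

/-- on `(0, π)`: `ψ(r) = cos r / sin r − r⁻¹` has derivative `−(sin²r)⁻¹ + (r²)⁻¹`. [folklore] -/
theorem hasDerivAt_cot_sub_inv {r : ℝ} (hr0 : 0 < r) (hrπ : r < Real.pi) :
    HasDerivAt (fun r => Real.cos r / Real.sin r - r⁻¹) (-(Real.sin r ^ 2)⁻¹ + (r ^ 2)⁻¹) r := by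
  have hsin : 0 < Real.sin r := Real.sin_pos_of_pos_of_lt_pi hr0 hrπ
  have hd1 : HasDerivAt (fun r => Real.cos r / Real.sin r)
      ((-Real.sin r * Real.sin r - Real.cos r * Real.cos r) / Real.sin r ^ 2) r :=
    (Real.hasDerivAt_cos r).div (Real.hasDerivAt_sin r) hsin.ne'
  have hd2 : HasDerivAt (fun r : ℝ => r⁻¹) (-(r ^ 2)⁻¹) r := hasDerivAt_inv hr0.ne'
  have hsc : -Real.sin r * Real.sin r - Real.cos r * Real.cos r = -1 := by
    linear_combination (-1 : ℝ) * Real.sin_sq_add_cos_sq r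
  refine (hd1.sub hd2).congr_deriv ?_
  rw [hsc, neg_div, one_div, sub_neg_eq_add]

/-- `−(sin²r)⁻¹ + (r²)⁻¹ ≤ 0` on `(0, π)`, because `0 < sin r ≤ r`. [folklore] -/
theorem inv_sq_sub_nonpos {r : ℝ} (hr0 : 0 < r) (hrπ : r < Real.pi) : -(Real.sin r ^ 2)⁻¹ + (r ^ 2)⁻¹ ≤ 0 := by
  have hsin : 0 < Real.sin r := Real.sin_pos_of_pos_of_lt_pi hr0 hrπ
  have hsq : Real.sin r ^ 2 ≤ r ^ 2 := pow_le_pow_left₀ hsin.le (Real.sin_le hr0.le) 2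
  have := inv_anti₀ (pow_pos hsin 2) hsq
  linarith

/-- **`log ∘ sinc` IS CONCAVE ON `[0, π)`** — the convexity half of caveat (JAC) of `T4HaarSU2ExpChart`, in the kernel.
[folklore] -/
theorem concaveOn_log_sinc : ConcaveOn ℝ (Ico 0 Real.pi) (fun r => Real.log (Real.sinc r)) := by
  have hint : interior (Ico 0 Real.pi) = Ioo 0 Real.pi := interior_Ico
  have hcont : ContinuousOn (fun r => Real.log (Real.sinc r)) (Ico 0 Real.pi) :=
    Real.continuous_sinc.continuousOn.log fun r hr => (sinc_pos_of_mem_Ico hr).ne'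
  have hdiff : DifferentiableOn ℝ (fun r => Real.log (Real.sinc r)) (interior (Ico 0 Real.pi)) := by
    rw [hint]; intro r hr
    exact (hasDerivAt_log_sinc hr.1 hr.2).differentiableAt.differentiableWithinAt
  have hderiv : EqOn (deriv fun r => Real.log (Real.sinc r)) (fun r => Real.cos r / Real.sin r - r⁻¹)
      (Ioo 0 Real.pi) := fun r hr => (hasDerivAt_log_sinc hr.1 hr.2).deriv
  have hψcont : ContinuousOn (fun r => Real.cos r / Real.sin r - r⁻¹) (Ioo 0 Real.pi) := fun r hr =>
    (hasDerivAt_cot_sub_inv hr.1 hr.2).continuousAt.continuousWithinAt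
  have hψdiff : DifferentiableOn ℝ (fun r => Real.cos r / Real.sin r - r⁻¹) (interior (Ioo 0 Real.pi)) := by
    rw [interior_Ioo]; intro r hr
    exact (hasDerivAt_cot_sub_inv hr.1 hr.2).differentiableAt.differentiableWithinAt
  have hψanti : AntitoneOn (fun r => Real.cos r / Real.sin r - r⁻¹) (Ioo 0 Real.pi) := by
    refine antitoneOn_of_deriv_nonpos (convex_Ioo 0 Real.pi) hψcont hψdiff fun r hr => ?_
    rw [interior_Ioo] at hr
    rw [(hasDerivAt_cot_sub_inv hr.1 hr.2).deriv]
    exact inv_sq_sub_nonpos hr.1 hr.2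
  have hanti : AntitoneOn (deriv fun r => Real.log (Real.sinc r)) (interior (Ico 0 Real.pi)) := by
    rw [hint]; exact hψanti.congr fun r hr => (hderiv hr).symm
  exact hanti.concaveOn_of_deriv (convex_Ico 0 Real.pi) hcont hdiff

/-- from concavity of `log ∘ g` on `[0,π)` (`g > 0` there) to the multiplicative three-point form of `g`.
[folklore] -/
theorem threePoint_of_concaveOn_log {g : ℝ → ℝ} (hpos : ∀ r ∈ Ico 0 Real.pi, 0 < g r)
    (hconc : ConcaveOn ℝ (Ico 0 Real.pi) fun r => Real.log (g r)) {a b s : ℝ} (ha : a ∈ Ico 0 Real.pi)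
    (hb : b ∈ Ico 0 Real.pi) (hs0 : 0 < s) (hs1 : s < 1) :
    g a ^ (1 - s) * g b ^ s ≤ g ((1 - s) * a + s * b) := by
  have h1s : 0 ≤ 1 - s := by linarith
  have hz : (1 - s) * a + s * b ∈ Ico 0 Real.pi := by
    have := (convex_Ico 0 Real.pi) ha hb h1s hs0.le (by ring)
    simpa only [smul_eq_mul] using this
  have hc := hconc.2 ha hb h1s hs0.le (by ring)
  simp only [smul_eq_mul] at hc
  rw [Real.rpow_def_of_pos (hpos a ha), Real.rpow_def_of_pos (hpos b hb), ← Real.exp_add,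
    ← Real.exp_log (hpos _ hz)]
  exact Real.exp_le_exp.2 (by linarith)

/-- **`sinc` IS LOG-CONCAVE ON `[0, π)`**: `sinc a^{1−s}·sinc b^s ≤ sinc((1−s)a + sb)`. [folklore] -/
theorem sinc_threePoint {a b s : ℝ} (ha : a ∈ Ico 0 Real.pi) (hb : b ∈ Ico 0 Real.pi) (hs0 : 0 < s)
    (hs1 : s < 1) : Real.sinc a ^ (1 - s) * Real.sinc b ^ s ≤ Real.sinc ((1 - s) * a + s * b) :=
  threePoint_of_concaveOn_log (fun _ hr => sinc_pos_of_mem_Ico hr) concaveOn_log_sinc ha hb hs0 hs1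

/-- the radial profile `(2π²)⁻¹ sinc² r` of the one-bond exponential Haar weight is log-concave on `[0, π)`
(`log` of it is a constant plus `2 log sinc`). [folklore] -/
theorem profile_threePoint {a b s : ℝ} (ha : a ∈ Ico 0 Real.pi) (hb : b ∈ Ico 0 Real.pi) (hs0 : 0 < s)
    (hs1 : s < 1) :
    ((2 * Real.pi ^ 2)⁻¹ * Real.sinc a ^ 2) ^ (1 - s) * ((2 * Real.pi ^ 2)⁻¹ * Real.sinc b ^ 2) ^ s ≤
      (2 * Real.pi ^ 2)⁻¹ * Real.sinc ((1 - s) * a + s * b) ^ 2 := by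
  have hc0 : 0 < (2 * Real.pi ^ 2)⁻¹ := by positivity
  have hpos : ∀ r ∈ Ico 0 Real.pi, 0 < (2 * Real.pi ^ 2)⁻¹ * Real.sinc r ^ 2 := fun r hr =>
    mul_pos hc0 (pow_pos (sinc_pos_of_mem_Ico hr) 2)
  refine threePoint_of_concaveOn_log hpos ?_ ha hb hs0 hs1
  have hsum : ConcaveOn ℝ (Ico 0 Real.pi)
      (fun r => Real.log ((2 * Real.pi ^ 2)⁻¹) + (2 : ℝ) • Real.log (Real.sinc r)) :=
    (concaveOn_const _ (convex_Ico 0 Real.pi)).add (concaveOn_log_sinc.smul zero_le_two)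
  refine hsum.congr fun r hr => ?_
  simp only [smul_eq_mul]
  rw [Real.log_mul hc0.ne' (pow_pos (sinc_pos_of_mem_Ico hr) 2).ne', Real.log_pow]
  norm_num

end Sinc

/-! ## §2 The one-bond weight and the block Jacobian of the exponential cube chart are log-concave -/

section Jacobian

open T4HaarSU2ExpChart (expWeight expWeight_nonneg)
open T4CubePoincare (cube mem_cube_iff)
open T4CubeChartGnomonic (regroup regroup_apply_eq)
open T4CubeChartExp (toE expCubeWeight expCubeWeight_nonneg expJac exp_neg_expJac regroup_mem_cube
  toE_mem_ball_of_mem_cube)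
open ShellMeasureScalingSU2 (sinc_le_sinc_of_le_of_le_pi)

/-- the radial profile is non-increasing on `[0, π]`. [folklore] -/
theorem profile_antitone {r r' : ℝ} (hr : 0 ≤ r) (hrr' : r ≤ r') (hr' : r' ≤ Real.pi) :
    (2 * Real.pi ^ 2)⁻¹ * Real.sinc r' ^ 2 ≤ (2 * Real.pi ^ 2)⁻¹ * Real.sinc r ^ 2 := by
  obtain ⟨h0, hle⟩ := sinc_le_sinc_of_le_of_le_pi hr hrr' hr'
  exact mul_le_mul_of_nonneg_left (pow_le_pow_left₀ h0 hle 2) (by positivity)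

/-- **THE ONE-BOND EXPONENTIAL HAAR WEIGHT `(2π²)⁻¹ sinc²‖x‖` IS LOG-CONCAVE ON THE INJECTIVITY BALL `‖x‖ < π`**
(three-point form): norm convexity, the profile non-increasing on `[0,π]`, the profile log-concave on `[0,π)`.
[folklore] -/
theorem expWeight_threePoint {x y : EuclideanSpace ℝ (Fin 3)} (hx : ‖x‖ < Real.pi) (hy : ‖y‖ < Real.pi)
    {s : ℝ} (hs0 : 0 < s) (hs1 : s < 1) :
    expWeight x ^ (1 - s) * expWeight y ^ s ≤ expWeight ((1 - s) • x + s • y) := by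
  have h1s : 0 ≤ 1 - s := by linarith
  have ha : ‖x‖ ∈ Ico 0 Real.pi := ⟨norm_nonneg x, hx⟩
  have hb : ‖y‖ ∈ Ico 0 Real.pi := ⟨norm_nonneg y, hy⟩
  have hm : (1 - s) * ‖x‖ + s * ‖y‖ ∈ Ico 0 Real.pi := by
    have := (convex_Ico 0 Real.pi) ha hb h1s hs0.le (by ring)
    simpa only [smul_eq_mul] using this
  have hzm : ‖(1 - s) • x + s • y‖ ≤ (1 - s) * ‖x‖ + s * ‖y‖ := by
    refine (norm_add_le _ _).trans ?_
    rw [norm_smul, norm_smul, Real.norm_of_nonneg h1s, Real.norm_of_nonneg hs0.le]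
  unfold expWeight
  exact (profile_threePoint ha hb hs0 hs1).trans (profile_antitone (norm_nonneg _) hzm hm.2.le)

variable {P : Params} {j : ℕ} (Λ : Finset (PBond P j)) {n : ℕ}

/-- the cube `[-S,S]ⁿ` is convex. [folklore] -/
theorem convex_cube (m : ℕ) (S : ℝ) : Convex ℝ (cube m S) :=
  convex_pi fun _ _ => convex_Icc _ _

/-- the bond blocks of a convex combination are the convex combinations of the bond blocks (coordinates are linear),
read through `toE`. [folklore] -/
theorem toE_regroup_combo (e : ↥Λ × Fin 3 ≃ Fin n) (x y : Fin n → ℝ) (s : ℝ) (b : ↥Λ) :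
    toE (regroup Λ e ((1 - s) • x + s • y) b) = (1 - s) • toE (regroup Λ e x b) + s • toE (regroup Λ e y b) := by
  rw [regroup_apply_eq, regroup_apply_eq, regroup_apply_eq]
  rfl

/-- **THE CHART-SIDE WEIGHT `1_{[-S,S]ⁿ}·e^{−jac_e}` OF THE TREE'S `SU(2)` EXPONENTIAL CUBE CHART IS A LOG-CONCAVE WEIGHT
ON `ℝⁿ`** (`3S² < π²`): on the cube `e^{−jac_e(x)} = ∏_b (2π²)⁻¹sinc²‖toE x_b‖` (`T4CubeChartExp.exp_neg_expJac`), each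
factor satisfies the three-point inequality (§2, blocks in the injectivity ball), products and the convex cube
preserve it. [folklore] -/
theorem isLogConcaveWeight_chartWeight (e : ↥Λ × Fin 3 ≃ Fin n) {S : ℝ} (hSπ : 3 * S ^ 2 < Real.pi ^ 2) :
    IsLogConcaveWeight fun x : Fin n → ℝ =>
      (cube n S).indicator (fun x => ENNReal.ofReal (Real.exp (-expJac Λ e x))) x := by
  intro x y s hs0 hs1
  dsimp only
  have h1s : 0 < 1 - s := by linarith
  by_cases hx : x ∈ cube n S
  · by_cases hy : y ∈ cube n S
    · have hz : (1 - s) • x + s • y ∈ cube n S := convex_cube n S hx hy h1s.le hs0.le (by ring)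
      rw [indicator_of_mem hx, indicator_of_mem hy, indicator_of_mem hz,
        ENNReal.ofReal_rpow_of_nonneg (Real.exp_pos _).le h1s.le,
        ENNReal.ofReal_rpow_of_nonneg (Real.exp_pos _).le hs0.le,
        ← ENNReal.ofReal_mul (Real.rpow_nonneg (Real.exp_pos _).le _),
        exp_neg_expJac e hSπ hx, exp_neg_expJac e hSπ hy, exp_neg_expJac e hSπ hz]
      refine ENNReal.ofReal_le_ofReal ?_
      have hnn : ∀ (w : Fin n → ℝ) (b : ↥Λ), b ∈ Finset.univ → 0 ≤ expCubeWeight (regroup Λ e w b) :=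
        fun w b _ => expCubeWeight_nonneg _
      rw [← Real.finsetProd_rpow _ _ (hnn x), ← Real.finsetProd_rpow _ _ (hnn y), ← Finset.prod_mul_distrib]
      refine Finset.prod_le_prod (fun b _ => by
        have := hnn x b (Finset.mem_univ b); have := hnn y b (Finset.mem_univ b); positivity) fun b _ => ?_
      -- one bond: the three-point inequality of the one-bond weight on the injectivity ball
      have hbx := mem_ball_zero_iff.1 (toE_mem_ball_of_mem_cube hSπ (regroup_mem_cube e hx b))
      have hby := mem_ball_zero_iff.1 (toE_mem_ball_of_mem_cube hSπ (regroup_mem_cube e hy b))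
      have h := expWeight_threePoint hbx hby hs0 hs1
      unfold expCubeWeight
      rwa [toE_regroup_combo]
    · rw [indicator_of_notMem hy, ENNReal.zero_rpow_of_pos hs0, mul_zero]; exact bot_le
  · rw [indicator_of_notMem hx, ENNReal.zero_rpow_of_pos h1s, zero_mul]; exact bot_le

end Jacobian

/-! ## §3 The realized SU(2) headline of member (λ) with (C-ii) on the block weight alone -/

section Realized

open T4CubePoincare (cube)
open T4CubeChartGnomonic (SU2)
open T4CubeChartExp (expJac expWindowDensity expFibreChart)
open T4ShellMeasureDet (blockLaw)
open ShellMeasureLogConcaveSU2 (slotAntiConcentration_realized_su2_of_logConcave)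

variable {P : Params} {j : ℕ} [DecidableEq (PBond P j)]

/-- **MEMBER (λ) FOR `G = SU(2)`, REALIZED, NO CHART-SIDE BINDER.**  As
`ShellMeasureLogConcaveSU2.slotAntiConcentration_realized_su2_of_logConcave`, with (C-ii) asked of the BLOCK WEIGHT
ALONE: per exterior `V`, `x ↦ 1_{[-S,S]ⁿ}(x)·R V(κ x)` is a log-concave weight (the window indicator only records that
nothing is asked off the cube); the Jacobian `e^{−jac_e}` rides free by `isLogConcaveWeight_chartWeight`.  (C-i)
convexity of the sectioned classifier on the support and (C-iii) the half-threshold mass ratio are unchanged;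
conclusion (M1) for the realized law with `D = 2P`. [folklore] -/
theorem slotAntiConcentration_realized_su2_of_logConcave_blockWeight (Λ : Finset (PBond P j)) {n : ℕ}
    (e : ↥Λ × Fin 3 ≃ Fin n) {S : ℝ} (hS : 0 < S) (hSπ : 3 * S ^ 2 < Real.pi ^ 2)
    (c : GaugeField P j SU2 → GaugeField P j SU2)
    {R : GaugeField P j SU2 → (↥Λ → SU2) → ℝ≥0∞} (hR : ∀ V, Measurable (R V))
    {F : GaugeField P j SU2 → ℝ≥0∞} (hF : Measurable F)
    (hFw : ∀ V y, F (updateFinset V Λ y) =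
      ENNReal.ofReal (expWindowDensity Λ (c V) S (updateFinset (c V) Λ y)) * R V y)
    (hfin : ∀ V, ((blockLaw Λ).withDensity fun y => F (updateFinset V Λ y)) univ ≠ ∞)
    {u : GaugeField P j SU2 → ℝ} (hu : Measurable u) {θ ρ Pm : ℝ} (hθ : 0 < θ) (hρ0 : 0 ≤ ρ) (hρ : ρ ≤ 1 / 2)
    (hPm : 0 ≤ Pm)
    (hlcR : ∀ V, IsLogConcaveWeight fun x : Fin n → ℝ =>
      (cube n S).indicator (fun x => R V (expFibreChart Λ (c V) e x)) x)
    (hconv : ∀ V, ConvexOnSupport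
      (fun x : Fin n → ℝ => (cube n S).indicator (fun x => ENNReal.ofReal (Real.exp (-expJac Λ e x))) x *
        R V (expFibreChart Λ (c V) e x))
      (fun x => u (updateFinset V Λ (expFibreChart Λ (c V) e x))))
    (hhalf : ∀ V, ((blockLaw Λ).withDensity fun y => F (updateFinset V Λ y)) univ ≤
      ENNReal.ofReal (Real.exp Pm) *
        ((blockLaw Λ).withDensity fun y => F (updateFinset V Λ y)) {y | u (updateFinset V Λ y) < θ / 2}) :
    SlotAntiConcentration ((fieldMeasure P j SU2).withDensity F) u θ ρ (2 * Pm) := by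
  refine slotAntiConcentration_realized_su2_of_logConcave Λ e hS hSπ c hR hF hFw hfin hu hθ hρ0 hρ hPm
    (fun V => ?_) hconv hhalf
  have h := isLogConcaveWeight_mul (isLogConcaveWeight_chartWeight Λ e hSπ) (hlcR V)
  have heq : (fun x : Fin n → ℝ =>
      (cube n S).indicator (fun x => ENNReal.ofReal (Real.exp (-expJac Λ e x))) x *
        (cube n S).indicator (fun x => R V (expFibreChart Λ (c V) e x)) x) =
      fun x => (cube n S).indicator (fun x => ENNReal.ofReal (Real.exp (-expJac Λ e x))) x *
        R V (expFibreChart Λ (c V) e x) := by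
    funext x
    by_cases hx : x ∈ cube n S
    · rw [indicator_of_mem hx, indicator_of_mem hx]
    · rw [indicator_of_notMem hx, indicator_of_notMem hx, zero_mul, zero_mul]
  rwa [heq] at h

end Realized

end Summit.QuantumFields.BalabanUV.T4Continuum.ShellMeasureLogConcaveJacobian
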